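import Summits.Schanuel.Schanuel.Theorems.RootDecomp1HCyclesRigid

/-!
# RootDecomp1H — ROUND 10 «CYCLIC CELLS», part 3 of 5 (§3 transversality off the tower hull; §4 the cell: presented at size one, near-c⋆-optimal, conjugation-stable)

All parts (`RootDecomp1HCyclesCore` §1+§2a, `RootDecomp1HCyclesRigid` §2b, `RootDecomp1HCyclesCell` §3–§4, `RootDecomp1HCyclesInstrument` §5,
`RootDecomp1HCycles` §6–§8) share the namespace `Summit.Schanuel.Schanuel.Theorems.RootDecomp1HCycles`; importers use `RootDecomp1HCycles`. lens-5 g10 (port rev d ac33957a); `--supports stmt-Schanuel-30564`.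
See part 1 (`RootDecomp1HCyclesCore`) for the account of the round.
-/

set_option linter.dupNamespace false

noncomputable section

namespace Summit.Schanuel.Schanuel.Theorems.RootDecomp1HCycles

open Complex Set
open Literature.NumberTheory.Transcendental (exists_nsmul_mem_span_int mem_adjoin_of_mem_span_int SchanuelRank Khovanskii.ePD)
open Summit.Schanuel.Schanuel.Theses.RootDecomp1H (ProductSchanuel RelTowerSchanuel BridgeTransverse FinCS)
open Summit.Schanuel.Schanuel.Theorems.RootDecomp1HTowerCells (trdeg_adjoin_adjoin_eq trdeg_adjoin_union_le
  trdeg_adjoin_range_le)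
open Summit.Schanuel.Schanuel.Theorems.RootDecomp1HCurveHull
open Summit.Schanuel.Schanuel.Theorems.RootDecomp1HClearance (LowerRanks CounterEx InTowerHull)
open Summit.Schanuel.Schanuel.Theorems.RootDecomp1HWitness
open Summit.Schanuel.Schanuel.Theorems.RootDecomp1HGauge

/-! ## 3. Transversality: a `ℚ`-free 3-cycle lies off the tower hull (under Schanuel on `𝓚`) -/

section transversal

variable {r c : Fin 3 → ℚ} {y : Fin 3 → ℂ}

/-- **TRANSVERSALITY OF CYCLES.**  Under Schanuel on the hull `𝓚` (⟺ `ProductSchanuel ∧ RelTowerSchanuel`), the span of a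
`ℚ`-free 3-cycle meets the span of every `ℚ`-free tower tuple trivially (round 8's `inf_towerSpan_eq_bot`, budget `1 ≤ 3 − 2`). -/
theorem cycle_inf_towerSpan_eq_bot (h : IsCycle r c y) (hS : SchanuelOn curveHull) (hy : LinearIndependent ℚ y) :
    ∀ (N : ℕ) (b : Fin N → ℂ), LinearIndependent ℚ b → TowerTuple b →
      ∀ v ∈ Submodule.span ℚ (range y), v ∈ Submodule.span ℚ (range b) → v = 0 :=
  inf_towerSpan_eq_bot hS (by norm_num) hy (rigid_cycle h) (selfAbsorbing_cycle h isCurveClosed_curveHull)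

/-- `span_ℚ y ∩ 𝓚 = 0` for a `ℚ`-free 3-cycle, under Schanuel on `𝓚`. -/
theorem cycle_transverse (h : IsCycle r c y) (hS : SchanuelOn curveHull) (hy : LinearIndependent ℚ y) :
    ∀ v ∈ Submodule.span ℚ (range y), v ∈ curveHull → v = 0 := by
  intro v hv hvK
  have hTS : TowerSchanuel := towerSchanuel_iff_schanuelOn_curveHull.mpr hS
  have hv' : v ∈ towerHullSet := by rw [towerHullSet_eq_curveHull hTS]; exact hvK
  obtain ⟨N, b, hb, htow, hvb⟩ := hv'
  exact cycle_inf_towerSpan_eq_bot h hS hy N b hb htow v hv hvb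

/-- **A `ℚ`-FREE 3-CYCLE LIES OFF THE TOWER HULL** (the fourth inline hypothesis of `BridgeTransverse`), under Schanuel on `𝓚`. -/
theorem not_inTowerHull_cycle (h : IsCycle r c y) (hS : SchanuelOn curveHull) (hy : LinearIndependent ℚ y) :
    ¬ InTowerHull y := by
  rintro ⟨N, b, hb, htow, hmem⟩
  exact hy.ne_zero 0 (cycle_inf_towerSpan_eq_bot h hS hy N b hb htow (y 0) (Submodule.subset_span ⟨0, rfl⟩) (hmem 0))

/-- The same under the route's structural binders `ProductSchanuel ∧ RelTowerSchanuel`. -/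
theorem not_inTowerHull_cycle_of_structural (h : IsCycle r c y) (hPS : ProductSchanuel) (hRT : RelTowerSchanuel)
    (hy : LinearIndependent ℚ y) : ¬ InTowerHull y :=
  not_inTowerHull_cycle h (schanuelOn_curveHull_of_structural hPS hRT) hy

/-- The same under Schanuel's conjecture itself. -/
theorem not_inTowerHull_cycle_of_schanuel (h : IsCycle r c y) (hSC : _root_.Schanuel) (hy : LinearIndependent ℚ y) :
    ¬ InTowerHull y :=
  not_inTowerHull_cycle h (schanuelOn_curveHull_of_schanuel hSC) hy

/-- Every coordinate of a `ℚ`-free 3-cycle lies OUTSIDE the hull `𝓚`, under Schanuel on `𝓚`. -/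
theorem cycle_not_mem_curveHull (h : IsCycle r c y) (hS : SchanuelOn curveHull) (hy : LinearIndependent ℚ y) (j : Fin 3) :
    y j ∉ curveHull := fun hj =>
  hy.ne_zero j (cycle_transverse h hS hy (y j) (Submodule.subset_span ⟨j, rfl⟩) hj)

end transversal

/-! ## 4. The cell: real unit 3-cycles are presented at size one, near-`c⋆`-optimal and conjugation-stable -/

section cell

/-- UNIT PARAMETERS: `ε_j = ±1`, `c_j ∈ {−1, 0, 1}`. -/
def UnitParams (ε c : Fin 3 → ℤ) : Prop := (∀ j, ε j = 1 ∨ ε j = -1) ∧ ∀ j, c j = -1 ∨ c j = 0 ∨ c j = 1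

/-- A cycle with integer parameters `(ε, c)`: `y_{j+1} = ε_j e^{y_j} + c_j`. -/
def IsIntCycle (ε c : Fin 3 → ℤ) (y : Fin 3 → ℂ) : Prop := ∀ j, y (j + 1) = (ε j : ℂ) * cexp (y j) + c j

/-- an integer cycle with non-zero `ε` is a rational cycle. -/
theorem IsIntCycle.isCycle {ε c : Fin 3 → ℤ} {y : Fin 3 → ℂ} (h : IsIntCycle ε c y) (hε : ∀ j, ε j ≠ 0) :
    IsCycle (fun j => (ε j : ℚ)) (fun j => (c j : ℚ)) y :=
  ⟨fun j => Int.cast_ne_zero.2 (hε j), fun j => by rw [h j]; push_cast; ring⟩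

/-- `ε j ≠ 0`. -/
theorem UnitParams.ε_ne {ε c : Fin 3 → ℤ} (hp : UnitParams ε c) (j : Fin 3) : ε j ≠ 0 := by
  rcases hp.1 j with h | h <;> simp [h]

/-- THE SIZE-ONE KHOVANSKII SYSTEM of a unit cycle: `X_{j+1} − ε_j Y_j − c_j` (`j ∈ ℤ/3`). -/
def gCyc (ε c : Fin 3 → ℤ) (j : Fin 3) : MvPolynomial (Fin 3 ⊕ Fin 3) ℚ :=
  MvPolynomial.X (Sum.inl (j + 1)) - MvPolynomial.C ((ε j : ℤ) : ℚ) * MvPolynomial.X (Sum.inr j) -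
    MvPolynomial.C ((c j : ℤ) : ℚ)

variable {ε c : Fin 3 → ℤ} {y : Fin 3 → ℂ}

/-- A cycle solves its system. -/
theorem aeval_gCyc (h : IsIntCycle ε c y) (j : Fin 3) : MvPolynomial.aeval (Sum.elim y (cexp ∘ y)) (gCyc ε c j) = 0 := by
  simp only [gCyc, map_sub, map_mul, MvPolynomial.aeval_X, MvPolynomial.aeval_C, Sum.elim_inl, Sum.elim_inr,
    Function.comp_apply, eq_ratCast, Rat.cast_intCast, h j]
  ring

/-- The system has size `≤ 1` (total degree `1`, coefficients `0, ±1`) for unit parameters. -/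
theorem size_gCyc (hp : UnitParams ε c) (j : Fin 3) :
    max (gCyc ε c j).totalDegree
      ((gCyc ε c j).support.sup fun m => max ((gCyc ε c j).coeff m).num.natAbs ((gCyc ε c j).coeff m).den) ≤ 1 := by
  classical
  have hint : ∀ z : ℤ, z.natAbs ≤ 1 → max ((z : ℚ)).num.natAbs ((z : ℚ)).den ≤ 1 := fun z hz => by
    rw [Rat.num_intCast, Rat.den_intCast]; exact max_le hz le_rfl
  refine max_le ?_ (Finset.sup_le fun m _ => ?_)
  · refine (MvPolynomial.totalDegree_sub _ _).trans (max_le ((MvPolynomial.totalDegree_sub _ _).trans (max_le ?_ ?_)) ?_)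
    · rw [MvPolynomial.totalDegree_X]
    · exact (MvPolynomial.totalDegree_mul _ _).trans (by rw [MvPolynomial.totalDegree_C, MvPolynomial.totalDegree_X])
    · rw [MvPolynomial.totalDegree_C]; exact zero_le_one
  · simp only [gCyc, MvPolynomial.coeff_sub, MvPolynomial.coeff_C_mul, MvPolynomial.coeff_X, MvPolynomial.coeff_C]
    have hne : Finsupp.single (Sum.inl (j + 1) : Fin 3 ⊕ Fin 3) 1 ≠ Finsupp.single (Sum.inr j) 1 := fun h =>
      Sum.inl_ne_inr (Finsupp.single_left_injective one_ne_zero h)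
    have hne0 : ∀ s : Fin 3 ⊕ Fin 3, (0 : (Fin 3 ⊕ Fin 3) →₀ ℕ) ≠ Finsupp.single s 1 := fun s h =>
      (Finsupp.single_ne_zero.2 one_ne_zero) h.symm
    by_cases h1 : Finsupp.single (Sum.inl (j + 1) : Fin 3 ⊕ Fin 3) 1 = m
    · rw [if_pos h1, if_neg (fun h2 => hne (h1.trans h2.symm)), if_neg (fun h3 => hne0 _ (h3.trans h1.symm))]
      simp
    · rw [if_neg h1]
      by_cases h2 : Finsupp.single (Sum.inr j : Fin 3 ⊕ Fin 3) 1 = m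
      · rw [if_pos h2, if_neg (fun h3 => hne0 _ (h3.trans h2.symm)), zero_sub, mul_one, sub_zero, ← Int.cast_neg]
        refine hint _ ?_
        rcases hp.1 j with h | h <;> simp [h]
      · rw [if_neg h2, mul_zero, sub_zero, zero_sub]
        by_cases h3 : (0 : (Fin 3 ⊕ Fin 3) →₀ ℕ) = m
        · rw [if_pos h3, ← Int.cast_neg]
          refine hint _ ?_
          rcases hp.2 j with h | h | h <;> simp [h]
        · rw [if_neg h3, neg_zero]
          simp

/-- The exponential Jacobian of the system at `(y, e^y)`. -/
theorem jacobian_gCyc (ε c : Fin 3 → ℤ) (y : Fin 3 → ℂ) :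
    (Matrix.of fun i j => MvPolynomial.aeval (Sum.elim y (cexp ∘ y)) (Khovanskii.ePD j (gCyc ε c i))) =
      !![-((ε 0 : ℂ) * cexp (y 0)), 1, 0; 0, -((ε 1 : ℂ) * cexp (y 1)), 1; 1, 0, -((ε 2 : ℂ) * cexp (y 2))] := by
  ext i j
  fin_cases i <;> fin_cases j <;>
    simp [gCyc, Khovanskii.ePD, MvPolynomial.pderiv_X, Matrix.of_apply, Pi.single_apply] <;> ring

/-- Its determinant: `1 − ε₀ ε₁ ε₂ · e^{y₀} e^{y₁} e^{y₂}`. -/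
theorem det_jacobian_gCyc (ε c : Fin 3 → ℤ) (y : Fin 3 → ℂ) :
    (Matrix.of fun i j => MvPolynomial.aeval (Sum.elim y (cexp ∘ y)) (Khovanskii.ePD j (gCyc ε c i))).det =
      1 - ((ε 0 * ε 1 * ε 2 : ℤ) : ℂ) * (cexp (y 0) * cexp (y 1) * cexp (y 2)) := by
  rw [jacobian_gCyc, Matrix.det_fin_three]
  simp only [Matrix.of_apply, Matrix.cons_val', Matrix.cons_val_zero, Matrix.cons_val_one, Matrix.cons_val_two,
    Matrix.empty_val', Matrix.cons_val_fin_one, Matrix.head_cons, Matrix.tail_cons, Matrix.head_fin_const]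
  push_cast
  ring

/-- For a REAL cycle with unit signs and `y₀ + y₁ + y₂ ≠ 0` the Jacobian does not vanish
(`e^{y₀+y₁+y₂} = ±1` forces `y₀ + y₁ + y₂ = 0`). -/
theorem det_jacobian_gCyc_ne_zero (hp : UnitParams ε c) (t : Fin 3 → ℝ) (hsum : t 0 + t 1 + t 2 ≠ 0) :
    (Matrix.of fun i j => MvPolynomial.aeval (Sum.elim (fun j => (t j : ℂ)) (cexp ∘ fun j => (t j : ℂ)))
      (Khovanskii.ePD j (gCyc ε c i))).det ≠ 0 := by
  rw [det_jacobian_gCyc]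
  have hprod : cexp (t 0 : ℂ) * cexp (t 1) * cexp (t 2) = ((Real.exp (t 0 + t 1 + t 2) : ℝ) : ℂ) := by
    rw [← Complex.exp_add, ← Complex.exp_add, Complex.ofReal_exp]; push_cast; ring_nf
  rw [hprod]
  have hσ : ε 0 * ε 1 * ε 2 = 1 ∨ ε 0 * ε 1 * ε 2 = -1 := by
    rcases hp.1 0 with h0 | h0 <;> rcases hp.1 1 with h1 | h1 <;> rcases hp.1 2 with h2 | h2 <;> simp [h0, h1, h2]
  have hpos := Real.exp_pos (t 0 + t 1 + t 2)
  rcases hσ with h | h <;> rw [h]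
  · rw [Int.cast_one, one_mul, sub_ne_zero, ne_comm, ← Complex.ofReal_one, Ne, Complex.ofReal_inj,
      Real.exp_eq_one_iff]
    exact hsum
  · rw [Int.cast_neg, Int.cast_one, show (1 : ℂ) - -1 * ((Real.exp (t 0 + t 1 + t 2) : ℝ) : ℂ) =
      ((1 + Real.exp (t 0 + t 1 + t 2) : ℝ) : ℂ) by push_cast; ring]
    exact Complex.ofReal_ne_zero.2 (by linarith)

/-- **A REAL UNIT 3-CYCLE IN THE BALL IS PRESENTED AT SIZE ONE.** -/
theorem presented_realUnitCycle (hp : UnitParams ε c) {t : Fin 3 → ℝ}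
    (hcyc : ∀ j, t (j + 1) = ε j * Real.exp (t j) + c j) (hball : ∀ j, |t j| ≤ 4) (hsum : t 0 + t 1 + t 2 ≠ 0) :
    Presented 3 1 (fun j => (t j : ℂ)) := by
  have hint : IsIntCycle ε c (fun j => (t j : ℂ)) := fun j => by
    simp only [hcyc j, Complex.ofReal_add, Complex.ofReal_mul, Complex.ofReal_intCast, Complex.ofReal_exp]
  refine ⟨⟨gCyc ε c, size_gCyc hp, aeval_gCyc hint, det_jacobian_gCyc_ne_zero hp t hsum⟩, ?_⟩
  rw [pi_norm_le_iff_of_nonneg (by positivity)]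
  intro j
  rw [Complex.norm_real, Real.norm_eq_abs]
  exact (hball j).trans (by norm_num)

/-- Nothing is presented at size `0` (a size-`0` polynomial is `0`: every coefficient has denominator `≥ 1`). -/
theorem not_presented_zero {n : ℕ} (hn : 0 < n) (y : Fin n → ℂ) : ¬ Presented n 0 y := by
  classical
  rintro ⟨⟨g, hsize, -, hdet⟩, -⟩
  apply hdet
  have hg : g ⟨0, hn⟩ = 0 := by
    ext m
    rw [MvPolynomial.coeff_zero]
    by_contra hm
    have hmem : m ∈ (g ⟨0, hn⟩).support := MvPolynomial.mem_support_iff.2 hm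
    have h1 := (le_max_right _ _).trans (hsize ⟨0, hn⟩)
    have h2 := (Finset.le_sup (f := fun m => max ((g ⟨0, hn⟩).coeff m).num.natAbs ((g ⟨0, hn⟩).coeff m).den) hmem).trans h1
    have h3 := (le_max_right _ _).trans h2
    exact absurd h3 (not_le.2 (Rat.den_pos _))
  exact Matrix.det_eq_zero_of_row_eq_zero ⟨0, hn⟩ fun j => by simp [Matrix.of_apply, hg, Khovanskii.ePD]

/-- **PRESENTED AT SIZE ONE ⟹ NEAR-`c⋆`-OPTIMAL** (with `c⋆ = 1`): the first inline hypothesis of the items, verbatim. -/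
theorem nearOpt_of_presented_one {n : ℕ} (hn : 0 < n) {y : Fin n → ℂ} (h : Presented n 1 y) : NearOpt n 1 y :=
  ⟨h, fun c' hc' ⟨y', _, hy'⟩ => by
    obtain rfl : c' = 0 := by omega
    exact not_presented_zero hn y' hy'⟩

/-- A real tuple is conjugation-stable (the second inline hypothesis of the items). -/
theorem conjStable_real {n : ℕ} (t : Fin n → ℝ) : ConjStable (fun j => (t j : ℂ)) := fun j => by
  rw [Complex.conj_ofReal]; exact Submodule.subset_span ⟨j, rfl⟩

/-- **THE CELL IS INHABITED BY CYCLES**: a real unit 3-cycle in the ball with `y₀ + y₁ + y₂ ≠ 0` is a near-`c⋆`-optimal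
(`c⋆ = 1`), conjugation-stable point of cell `(3, 1)` — unconditionally. -/
theorem realUnitCycle_mem_cell (hp : UnitParams ε c) {t : Fin 3 → ℝ}
    (hcyc : ∀ j, t (j + 1) = ε j * Real.exp (t j) + c j) (hball : ∀ j, |t j| ≤ 4) (hsum : t 0 + t 1 + t 2 ≠ 0) :
    NearOpt 3 1 (fun j => (t j : ℂ)) ∧ ConjStable (fun j => (t j : ℂ)) :=
  ⟨nearOpt_of_presented_one (by norm_num) (presented_realUnitCycle hp hcyc hball hsum), conjStable_real t⟩

end cell

end Summit.Schanuel.Schanuel.Theorems.RootDecomp1HCycles
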